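import Summits.ResolutionOfSingularities.ResolutionOfSingularities.Theorems.DeltaCutMirror2
import HarnessLib

/-!
# DeltaCutMirror3 — tree file 3/3 of the decomp-res lens-6 g29 node «MirrorCut» (HOME `decomp-res-lens-6/g29/MirrorCut.lean`)

§C `MCertificatesC` (the MEMORY PRICE, `p = 3`): `planeF_top`, `planeF_plane_bad`, `Dm_memory_noTop`, `Dm_memory_certificate`.
The module docstring of `DeltaCutMirror1` (file 1/3) carries the node's summary, the dictionary sentences certified,
the honest ceiling and the
sources; `NODE-g29.md` (HOME) is the record.  Same namespace `…Theorems.DeltaCutClasses`, `variable {K : Type*}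
[Field K]`, declarations verbatim
from the lens file. [new; elementary] [folklore]
-/


noncomputable section

open CategoryTheory CategoryTheory.Limits AlgebraicGeometry TopologicalSpace IsLocalRing
open Literature.AlgebraicGeometry.Resolution

universe u

open Summit.ResolutionOfSingularities.ResolutionOfSingularities.Theorems.Rescue.BedZpeBinom4Centre (mul_mem_pow_add)

namespace Summit.ResolutionOfSingularities.ResolutionOfSingularities.Theorems.DeltaCutClasses

open Summit.ResolutionOfSingularities.ResolutionOfSingularities.Theorems.TwistCutClasses
open Summit.ResolutionOfSingularities.ResolutionOfSingularities.Theorems.LightCutClasses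

section MCertificatesC

open MvPolynomial
variable {K : Type*} [Field K]

/-! #### §C — the MEMORY PRICE: the composite [L; OLD planes; NEW planes] decides `D′` at height 3 (`p = 3`) -/

/-- **LEVEL 2 GERM `F₂ = z³ + u·t³` — (T)+(W)+(B″)**: its top locus is EXACTLY the plane `V(z,t)` (`∂_u F₂ = t³`; `F₂ ∈
(z,t)³`; `u, w ∉ (z,t)`), every point of it BAD (`Diff^{≤2}(F₂) = (F₂, t³) ⊆ (z,t)³`, char 3): bad₂ = the closed points of a
REGULAR plane — the memoryless separating hop FIRES here (blow up `V(z,t)`).  Characteristic-free except (B″). [new;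
elementary] [folklore] -/
theorem planeF_top (𝔮 : Ideal (MvPolynomial (Fin 4) K)) [𝔮.IsPrime] {s : MvPolynomial (Fin 4) K} (hs : s ∉ 𝔮)
    (h : s * (X 0 ^ 3 + X 2 * X 1 ^ 3 : MvPolynomial (Fin 4) K) ∈ 𝔮 ^ 3) :
    (X 0 : MvPolynomial (Fin 4) K) ∈ 𝔮 ∧ (X 1 : MvPolynomial (Fin 4) K) ∈ 𝔮 := by
  have hP := ‹𝔮.IsPrime›
  have hs2 : s ^ 2 ∉ 𝔮 := pow_not_mem 𝔮 hs 2
  have e20 := f_ne K (i := 2) (j := 0) (by decide)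
  have e21 := f_ne K (i := 2) (j := 1) (by decide)
  have e22 := f_self K 2
  have d2 : pderiv 2 (X 0 ^ 3 + X 2 * X 1 ^ 3 : MvPolynomial (Fin 4) K) = X 1 ^ 3 := by
    simp only [map_add, Derivation.leibniz, Derivation.leibniz_pow, smul_eq_mul, nsmul_eq_mul, e20, e21, e22]
    push_cast; ring
  have h1 := sq_mul_deriv_mem_pow 𝔮 h (pderiv 2)
  rw [d2] at h1
  have ht3 : (X 1 ^ 3 : MvPolynomial (Fin 4) K) ∈ 𝔮 := (hP.mem_or_mem (Ideal.pow_le_self two_ne_zero h1)).resolve_left hs2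
  have hf : (X 0 ^ 3 + X 2 * X 1 ^ 3 : MvPolynomial (Fin 4) K) ∈ 𝔮 := mem_of_sMul_mem_cube 𝔮 hs h
  have h0 : (X 0 ^ 3 : MvPolynomial (Fin 4) K) ∈ 𝔮 := by
    have := Ideal.sub_mem _ hf (Ideal.mul_mem_left _ (X 2) ht3)
    rwa [show (X 0 ^ 3 + X 2 * X 1 ^ 3 - X 2 * X 1 ^ 3 : MvPolynomial (Fin 4) K) = X 0 ^ 3 by ring] at this
  exact ⟨hP.mem_of_pow_mem 3 h0, hP.mem_of_pow_mem 3 ht3⟩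

/-- `F₂ = z³ + u·t³`: (W) `F₂ ∈ (z,t)³`; (B″) `∂_z F₂ = ∂_t F₂ = ∂_w F₂ = 0`, `∂_u F₂ = t³`, `∂ᵢ t³ = 0` (char 3), `(F₂, t³) ⊆
(z,t)³`. [new; elementary] [folklore] -/
theorem planeF_plane_bad [CharP K 3] :
    (X 0 ^ 3 + X 2 * X 1 ^ 3 : MvPolynomial (Fin 4) K) ∈ (Ideal.span {(X 0 : MvPolynomial (Fin 4) K), X 1}) ^ 3 ∧
    (pderiv 0 (X 0 ^ 3 + X 2 * X 1 ^ 3 : MvPolynomial (Fin 4) K) = 0 ∧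
      pderiv 1 (X 0 ^ 3 + X 2 * X 1 ^ 3 : MvPolynomial (Fin 4) K) = 0 ∧
      pderiv 3 (X 0 ^ 3 + X 2 * X 1 ^ 3 : MvPolynomial (Fin 4) K) = 0 ∧
      pderiv 2 (X 0 ^ 3 + X 2 * X 1 ^ 3 : MvPolynomial (Fin 4) K) = X 1 ^ 3) ∧
    (∀ i : Fin 4, pderiv i (X 1 ^ 3 : MvPolynomial (Fin 4) K) = 0) ∧
    Ideal.span {(X 0 ^ 3 + X 2 * X 1 ^ 3 : MvPolynomial (Fin 4) K), X 1 ^ 3} ≤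
      (Ideal.span {(X 0 : MvPolynomial (Fin 4) K), X 1}) ^ 3 := by
  have h3 := three_eq_zero_mvPolynomial (K := K)
  have e00 := f_self K 0
  have e01 := f_ne K (i := 0) (j := 1) (by decide)
  have e02 := f_ne K (i := 0) (j := 2) (by decide)
  have e10 := f_ne K (i := 1) (j := 0) (by decide)
  have e11 := f_self K 1
  have e12 := f_ne K (i := 1) (j := 2) (by decide)
  have e30 := f_ne K (i := 3) (j := 0) (by decide)
  have e31 := f_ne K (i := 3) (j := 1) (by decide)
  have e32 := f_ne K (i := 3) (j := 2) (by decide)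
  have e20 := f_ne K (i := 2) (j := 0) (by decide)
  have e21 := f_ne K (i := 2) (j := 1) (by decide)
  have e22 := f_self K 2
  have a0 : (X 0 : MvPolynomial (Fin 4) K) ∈ Ideal.span {(X 0 : MvPolynomial (Fin 4) K), X 1} := Ideal.subset_span (by simp)
  have a1 : (X 1 : MvPolynomial (Fin 4) K) ∈ Ideal.span {(X 0 : MvPolynomial (Fin 4) K), X 1} := Ideal.subset_span (by simp)
  have hF : (X 0 ^ 3 + X 2 * X 1 ^ 3 : MvPolynomial (Fin 4) K) ∈ (Ideal.span {(X 0 : MvPolynomial (Fin 4) K), X 1}) ^ 3 :=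
    Ideal.add_mem _ (Ideal.pow_mem_pow a0 3) (Ideal.mul_mem_left _ _ (Ideal.pow_mem_pow a1 3))
  have d0 : pderiv 0 (X 0 ^ 3 + X 2 * X 1 ^ 3 : MvPolynomial (Fin 4) K) = 0 := by
    simp only [map_add, Derivation.leibniz, Derivation.leibniz_pow, smul_eq_mul, nsmul_eq_mul, e00, e01, e02]
    push_cast
    linear_combination (X 0 ^ 2 : MvPolynomial (Fin 4) K) * h3
  have d1 : pderiv 1 (X 0 ^ 3 + X 2 * X 1 ^ 3 : MvPolynomial (Fin 4) K) = 0 := by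
    simp only [map_add, Derivation.leibniz, Derivation.leibniz_pow, smul_eq_mul, nsmul_eq_mul, e10, e11, e12]
    push_cast
    linear_combination (X 2 * X 1 ^ 2 : MvPolynomial (Fin 4) K) * h3
  have d3 : pderiv 3 (X 0 ^ 3 + X 2 * X 1 ^ 3 : MvPolynomial (Fin 4) K) = 0 := by
    simp only [map_add, Derivation.leibniz, Derivation.leibniz_pow, smul_eq_mul, nsmul_eq_mul, e30, e31, e32]
    push_cast; ring
  have d2 : pderiv 2 (X 0 ^ 3 + X 2 * X 1 ^ 3 : MvPolynomial (Fin 4) K) = X 1 ^ 3 := by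
    simp only [map_add, Derivation.leibniz, Derivation.leibniz_pow, smul_eq_mul, nsmul_eq_mul, e20, e21, e22]
    push_cast; ring
  have c : ∀ i : Fin 4, pderiv i (X 1 ^ 3 : MvPolynomial (Fin 4) K) = 0 := by
    intro i
    by_cases hi : i = 1
    · subst hi
      simp only [Derivation.leibniz_pow, smul_eq_mul, nsmul_eq_mul, e11]
      push_cast
      linear_combination (X 1 ^ 2 : MvPolynomial (Fin 4) K) * h3
    · have e := f_ne K (i := i) (j := 1) (Ne.symm hi)
      simp only [Derivation.leibniz_pow, smul_eq_mul, nsmul_eq_mul, e]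
      push_cast; ring
  refine ⟨hF, ⟨d0, d1, d3, d2⟩, c, ?_⟩
  refine Ideal.span_le.2 ?_
  rintro g hg
  simp only [Set.mem_insert_iff, Set.mem_singleton_iff] at hg
  rcases hg with rfl | rfl
  · exact hF
  · exact Ideal.pow_mem_pow a1 3

/-- **MEMORY HEIGHT 3 — every unit-form chart has NO top point**: step 2 chart `z` (`1 + u·t³w³`), step 3 chart `z` (`1 +
u·t³`) and step 3 chart `t` (`z³ + u`: `∂_u = 1`, order `≤ 1` everywhere).  Characteristic-free. [new; elementary] [folklore] -/
theorem Dm_memory_noTop (𝔮 : Ideal (MvPolynomial (Fin 4) K)) [𝔮.IsPrime] {s : MvPolynomial (Fin 4) K} (hs : s ∉ 𝔮) :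
    (s * (1 + X 2 * X 1 ^ 3 * X 3 ^ 3 : MvPolynomial (Fin 4) K) ∈ 𝔮 ^ 3 → False) ∧
    (s * (1 + X 2 * X 1 ^ 3 : MvPolynomial (Fin 4) K) ∈ 𝔮 ^ 3 → False) ∧
    (s * (X 0 ^ 3 + X 2 : MvPolynomial (Fin 4) K) ∈ 𝔮 ^ 3 → False) := by
  have hs2 : s ^ 2 ∉ 𝔮 := pow_not_mem 𝔮 hs 2
  have e20 := f_ne K (i := 2) (j := 0) (by decide)
  have e21 := f_ne K (i := 2) (j := 1) (by decide)
  have e23 := f_ne K (i := 2) (j := 3) (by decide)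
  have e22 := f_self K 2
  have m1 : pderiv 2 (X 1 ^ 3 * X 3 ^ 3 : MvPolynomial (Fin 4) K) = 0 := by
    simp only [Derivation.leibniz, Derivation.leibniz_pow, smul_eq_mul, nsmul_eq_mul, e21, e23]
    push_cast; ring
  have m2 : pderiv 2 (X 1 ^ 3 : MvPolynomial (Fin 4) K) = 0 := by
    simp only [Derivation.leibniz_pow, smul_eq_mul, nsmul_eq_mul, e21]
    push_cast; ring
  refine ⟨fun h => noTop_one_add_u_mul _ m1 𝔮 hs ?_, fun h => noTop_one_add_u_mul _ m2 𝔮 hs h, fun h => ?_⟩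
  · rwa [show (1 + X 2 * (X 1 ^ 3 * X 3 ^ 3) : MvPolynomial (Fin 4) K) = 1 + X 2 * X 1 ^ 3 * X 3 ^ 3 by ring]
  · have d2 : pderiv 2 (X 0 ^ 3 + X 2 : MvPolynomial (Fin 4) K) = 1 := by
      simp only [map_add, Derivation.leibniz_pow, smul_eq_mul, nsmul_eq_mul, e20, e22]
      push_cast; ring
    have h1 := sq_mul_deriv_mem_pow 𝔮 h (pderiv 2)
    rw [d2, mul_one] at h1
    exact hs2 (Ideal.pow_le_self two_ne_zero h1)

/-- **D′ — THE MEMORY-PRICE CERTIFICATE (height 3).**  The composite law [blow up `L`; then the strict transforms `V(z',w')`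
(chart `t`) / `V(z',t')` (chart `w`) of the two OLD planes — told apart from the NEW exceptional plane only by MEMORY; then
the NEW planes] resolves `D′`: every chart of every step is listed — step 1: `t ↦ D′`, `w ↦ D′`, `z ↦` no top
(`Dm_selfReproduction_certificate`); step 2 (chart `t`; chart `w` is its mirror): `w ↦ F₂ = z³ + u·t³`, `z ↦` no top; `F₂`:
top = bad = the REGULAR plane `V(z,t)` (memoryless hop fires); step 3: `t ↦ z³ + u` (order `≤ 1`), `z ↦` no top.  Bad locus
EMPTY at height `3`.  The same ONE BIT («which components are old») is what the barrier (NODE-g29.md §2) shows a memoryless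
law cannot supply. [new] [folklore] -/
theorem Dm_memory_certificate [CharP K 3] :
    -- step 2 charts
    (aeval (linChartSubst (K := K) {0, 3} 3) (mirrorF (K := K) 3) = X 3 ^ 3 * (X 0 ^ 3 + X 2 * X 1 ^ 3) ∧
      aeval (linChartSubst (K := K) {0, 3} 0) (mirrorF (K := K) 3) = X 0 ^ 3 * (1 + X 2 * X 1 ^ 3 * X 3 ^ 3)) ∧
    -- F₂: top = the plane V(z,t), all bad
    (∀ (𝔮 : Ideal (MvPolynomial (Fin 4) K)) [𝔮.IsPrime], ∀ s ∉ 𝔮,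
        s * (X 0 ^ 3 + X 2 * X 1 ^ 3 : MvPolynomial (Fin 4) K) ∈ 𝔮 ^ 3 →
          (X 0 : MvPolynomial (Fin 4) K) ∈ 𝔮 ∧ (X 1 : MvPolynomial (Fin 4) K) ∈ 𝔮) ∧
    ((X 0 ^ 3 + X 2 * X 1 ^ 3 : MvPolynomial (Fin 4) K) ∈ (Ideal.span {(X 0 : MvPolynomial (Fin 4) K), X 1}) ^ 3 ∧
      Ideal.span {(X 0 ^ 3 + X 2 * X 1 ^ 3 : MvPolynomial (Fin 4) K), X 1 ^ 3} ≤
        (Ideal.span {(X 0 : MvPolynomial (Fin 4) K), X 1}) ^ 3) ∧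
    -- step 3 charts
    (aeval (linChartSubst (K := K) {0, 1} 1) (X 0 ^ 3 + X 2 * X 1 ^ 3 : MvPolynomial (Fin 4) K) = X 1 ^ 3 * (X 0 ^ 3 + X 2) ∧
      aeval (linChartSubst (K := K) {0, 1} 0) (X 0 ^ 3 + X 2 * X 1 ^ 3 : MvPolynomial (Fin 4) K) =
        X 0 ^ 3 * (1 + X 2 * X 1 ^ 3)) ∧
    -- no top point in the unit-form charts and at height 3
    (∀ (𝔮 : Ideal (MvPolynomial (Fin 4) K)) [𝔮.IsPrime], ∀ s ∉ 𝔮,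
        (s * (1 + X 2 * X 1 ^ 3 * X 3 ^ 3 : MvPolynomial (Fin 4) K) ∈ 𝔮 ^ 3 → False) ∧
        (s * (1 + X 2 * X 1 ^ 3 : MvPolynomial (Fin 4) K) ∈ 𝔮 ^ 3 → False) ∧
        (s * (X 0 ^ 3 + X 2 : MvPolynomial (Fin 4) K) ∈ 𝔮 ^ 3 → False)) :=
  ⟨⟨mirrorF_oldPlaneChart_w 3, mirrorF_oldPlaneChart_z 3⟩, fun 𝔮 _ _ hs h => planeF_top 𝔮 hs h,
    ⟨(planeF_plane_bad (K := K)).1, (planeF_plane_bad (K := K)).2.2.2⟩,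
    ⟨planeF_newPlaneChart_t 3, planeF_newPlaneChart_z 3⟩, fun 𝔮 _ _ hs => Dm_memory_noTop 𝔮 hs⟩

end MCertificatesC

end Summit.ResolutionOfSingularities.ResolutionOfSingularities.Theorems.DeltaCutClasses
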